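import Summits.NavierStokesRegularity.NavierStokesRegularity.Theses.TypeIQuarterGate
import Summits.NavierStokesRegularity.NavierStokesRegularity.Theorems.TypeIQuarterGateLorentzOctaveSampling
import Summits.NavierStokesRegularity.NavierStokesRegularity.Theorems.TypeIQuarterGateLorentzUpgradeIffQuarterLaw
import Summits.NavierStokesRegularity.NavierStokesRegularity.Theorems.TypeIQuarterGateQuarterLawTypeISamplingTFAE
import Literature.Analysis.FunctionSpaces.WeakLp
import HarnessLib

/-!
# `TypeIQuarterGate`: octave sampling of the Lorentz bound — corollaries and the BY-NAME equivalences
# (crux `QuarterLawTypeI`, stmt-NavierStokesRegularity-23726; open stub `stub_lorentzUpgrade` = item 24108)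

`--supports stmt-NavierStokesRegularity-23726` (helper, def-free).  Consequences of the per-scale count
`LorentzOctave.count_of_octaveSampledLorentz` (file `TypeIQuarterGateLorentzOctaveSampling.lean`): along a
maximal classical Leray–Hopf solution from a rapidly decaying datum with the sup-norm Type-I rate at `T`,
a weak-`L³` bound `sup_λ λ³|{λ < ‖u(t)‖}| ≤ M` at ONE time per backward window `δ ≤ T − t ≤ q δ`
(`0 < δ ≤ δ₀`) gives

* `lorentzBound_of_octaveSampledLorentz` — the FULL bound `∃ M', ∀ t ∈ [0,T), sup_λ λ³|{λ<‖u(t)‖}| ≤ M'`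
  (tree `LorentzOfEnvelope.lorentzBound_of_count`);
* `quarterLaw_of_octaveSampledLorentz` — Leray's quarter law `∫‖curl u(t)‖² ≤ K/√(T−t)` on `[0,T)`
  (tree `CountQuarterLaw.stub_countQuarterLaw`);
* `lorentzBound_of_lacunaryLorentzSeq` — instrument form along ANY sequence `t_n → T` in `[0,T)` with
  bounded scale ratios `T − t_n ≤ q (T − t_{n+1})`;
* BY NAME: `lorentzUpgradeTypeI_iff_octaveSampled` and `quarterLawTypeI_iff_octaveSampledLorentz` — the
  open item `LorentzUpgradeTypeI` (24108) and the crux `QuarterLawTypeI` (23726) are each equivalent to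
  the OCTAVE-SAMPLED Lorentz bound.  Repair-census wording: the missing estimate of the fixed point is ONE
  weak-`L³` slice bound per backward time-octave near `T` (any fixed ratio `q`), nothing at other times.

HONEST FRAMING: a-priori statements along a HYPOTHETICAL Type-I blow-up; `LorentzUpgradeTypeI` (24108),
`QuarterLawTypeI` (23726) remain OPEN; nothing about Navier–Stokes regularity or blow-up is claimed and
no summit statement is proved. [folklore]
-/

noncomputable section

-- the summit-side namespace repeats a component by design (D-0017)
set_option linter.dupNamespace false

namespace Summit.NavierStokesRegularity.NavierStokesRegularity.Theorems.LorentzOctave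

open Set MeasureTheory Function Metric Filter Topology
open scoped ENNReal NNReal
open Literature.Analysis.FluidPDE Literature.Analysis.FunctionSpaces
open Summit.NavierStokesRegularity.NavierStokesRegularity.Theorems.CountQuarterLaw

/-- **Octave-sampled weak-`L³` bound ⟹ the full Lorentz Type-I bound.**  Along a maximal classical
Leray–Hopf solution from a rapidly decaying datum with the sup-norm Type-I rate at `T`, a weak-`L³`
bound at ONE time per backward window `δ ≤ T − t ≤ q δ` (`0 < δ ≤ δ₀`) is already the uniform bound
`∃ M', ∀ t ∈ [0,T), sup_λ λ³|{λ < ‖u(t)‖}| ≤ M'` (tree: count ⟹ Lorentz,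
`LorentzOfEnvelope.lorentzBound_of_count`). [cite: BarkerPrange2020, Thm 1] -/
theorem lorentzBound_of_octaveSampledLorentz {ν T : ℝ} (hν : 0 < ν) (hT : 0 < T)
    {u : ℝ → EuclideanSpace ℝ (Fin 3) → EuclideanSpace ℝ (Fin 3)}
    {p : ℝ → EuclideanSpace ℝ (Fin 3) → ℝ}
    (hmax : IsMaximalSmoothSolution ν 0 u p T) (hLH : IsLerayHopfOn T ν 0 (u 0) u)
    (hdec : HasRapidSpatialDecay (u 0)) (hI : IsTypeIBlowup u T)
    {q M δ₀ : ℝ} (hδ₀ : 0 < δ₀)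
    (hsample : ∀ δ : ℝ, 0 < δ → δ ≤ δ₀ → ∃ t ∈ Ico 0 T, δ ≤ T - t ∧ T - t ≤ q * δ ∧
      eWeakLpPow (u t) 3 volume ≤ ENNReal.ofReal M) :
    ∃ M' : ℝ, ∀ t ∈ Ico 0 T, eWeakLpPow (u t) 3 volume ≤ ENNReal.ofReal M' :=
  LorentzOfEnvelope.lorentzBound_of_count hν hT hmax.1 hLH hdec hI
    (count_of_octaveSampledLorentz hν hT hmax hLH hdec hI hδ₀ hsample)

/-- **Octave-sampled weak-`L³` bound ⟹ Leray's quarter law** `∫‖curl u(t)‖² ≤ K/√(T−t)` on `[0,T)`,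
along a maximal classical Leray–Hopf solution from a rapidly decaying datum with the sup-norm Type-I
rate (tree: the registered stub `CountQuarterLaw.stub_countQuarterLaw`, count ⟹ quarter law).
[cite: BarkerPrange2020, Thm 1] -/
theorem quarterLaw_of_octaveSampledLorentz {ν T : ℝ} (hν : 0 < ν) (hT : 0 < T)
    {u : ℝ → EuclideanSpace ℝ (Fin 3) → EuclideanSpace ℝ (Fin 3)}
    {p : ℝ → EuclideanSpace ℝ (Fin 3) → ℝ}
    (hmax : IsMaximalSmoothSolution ν 0 u p T) (hLH : IsLerayHopfOn T ν 0 (u 0) u)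
    (hdec : HasRapidSpatialDecay (u 0)) (hI : IsTypeIBlowup u T)
    {q M δ₀ : ℝ} (hδ₀ : 0 < δ₀)
    (hsample : ∀ δ : ℝ, 0 < δ → δ ≤ δ₀ → ∃ t ∈ Ico 0 T, δ ≤ T - t ∧ T - t ≤ q * δ ∧
      eWeakLpPow (u t) 3 volume ≤ ENNReal.ofReal M) :
    ∃ K : ℝ, ∀ t ∈ Ico 0 T, ∫⁻ x, ‖curl (u t) x‖ₑ ^ 2 ≤ ENNReal.ofReal (K / Real.sqrt (T - t)) :=
  stub_countQuarterLaw ν T hν hT u p hmax hLH hdec hI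
    (count_of_octaveSampledLorentz hν hT hmax hLH hdec hI hδ₀ hsample)

/-- **Instrument form: a LACUNARY SEQUENCE of weak-`L³`-bounded slices is the full bound.**  Along a
maximal classical Leray–Hopf solution from a rapidly decaying datum with the sup-norm Type-I rate at
`T`: if `t_n → T` in `[0,T)` with bounded scale ratios `T − t_n ≤ q (T − t_{n+1})` and
`sup_n sup_λ λ³|{λ < ‖u(t_n)‖}| ≤ M`, then `sup_{t<T} sup_λ λ³|{λ < ‖u(t)‖}| < ∞`. [folklore] -/
theorem lorentzBound_of_lacunaryLorentzSeq {ν T : ℝ} (hν : 0 < ν) (hT : 0 < T)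
    {u : ℝ → EuclideanSpace ℝ (Fin 3) → EuclideanSpace ℝ (Fin 3)}
    {p : ℝ → EuclideanSpace ℝ (Fin 3) → ℝ}
    (hmax : IsMaximalSmoothSolution ν 0 u p T) (hLH : IsLerayHopfOn T ν 0 (u 0) u)
    (hdec : HasRapidSpatialDecay (u 0)) (hI : IsTypeIBlowup u T)
    {t : ℕ → ℝ} {q M : ℝ} (hmem : ∀ n, t n ∈ Ico 0 T) (hlim : Tendsto t atTop (𝓝 T))
    (hratio : ∀ n, T - t n ≤ q * (T - t (n + 1)))
    (hbound : ∀ n, eWeakLpPow (u (t n)) 3 volume ≤ ENNReal.ofReal M) :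
    ∃ M' : ℝ, ∀ s ∈ Ico 0 T, eWeakLpPow (u s) 3 volume ≤ ENNReal.ofReal M' := by
  classical
  have hq : 0 < q := by
    by_contra hq
    rw [not_lt] at hq
    have h0 := hratio 0
    have h1 : 0 < T - t 1 := by linarith [(hmem 1).2]
    have h2 : 0 < T - t 0 := by linarith [(hmem 0).2]
    nlinarith
  have hδ₀ : 0 < T - t 0 := by linarith [(hmem 0).2]
  refine lorentzBound_of_octaveSampledLorentz hν hT hmax hLH hdec hI (q := q) (M := M) hδ₀ ?_
  intro δ hδ hδle
  -- the first index whose slice is closer to `T` than `δ`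
  have hev : ∃ m, T - t m < δ := by
    have h1 : Tendsto (fun n => T - t n) atTop (𝓝 (T - T)) := tendsto_const_nhds.sub hlim
    rw [sub_self] at h1
    exact (h1.eventually (gt_mem_nhds hδ)).exists
  set m : ℕ := Nat.find hev with hm_def
  have hm : T - t m < δ := Nat.find_spec hev
  have hm0 : m ≠ 0 := by
    intro h0
    rw [h0] at hm
    linarith
  obtain ⟨n, hn⟩ := Nat.exists_eq_succ_of_ne_zero hm0
  have hnm : n < m := by rw [hn]; exact Nat.lt_succ_self n
  have hnδ : δ ≤ T - t n := by
    have := Nat.find_min hev hnm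
    rwa [not_lt] at this
  have hsucc : T - t (n + 1) < δ := by
    have e : n + 1 = m := by rw [hn]
    rw [e]; exact hm
  refine ⟨t n, hmem n, hnδ, ?_, hbound n⟩
  calc T - t n ≤ q * (T - t (n + 1)) := hratio n
    _ ≤ q * δ := mul_le_mul_of_nonneg_left hsucc.le hq.le

open Summit.NavierStokesRegularity.NavierStokesRegularity.Theses.TypeIQuarterGate in
/-- **BY NAME: `LorentzUpgradeTypeI` ⟺ its OCTAVE-SAMPLED form.**  The open item 24108 (time-Type-I ⟹
uniformly bounded weak-`L³` slices) is equivalent to: along every such blow-up there are a ratio `q`,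
a bound `M` and `δ₀ > 0` such that every backward window `δ ≤ T − t ≤ q δ` (`0 < δ ≤ δ₀`) contains a
time `t ∈ [0,T)` with `sup_λ λ³|{λ < ‖u(t)‖}| ≤ M`.  (⟹: `q = 1`, `t = T − δ`; ⟸:
`lorentzBound_of_octaveSampledLorentz`.)  `LorentzUpgradeTypeI` remains OPEN. [folklore] -/
theorem lorentzUpgradeTypeI_iff_octaveSampled :
    LorentzUpgradeTypeI ↔
      ∀ (ν T : ℝ), 0 < ν → 0 < T →
        ∀ (u : ℝ → EuclideanSpace ℝ (Fin 3) → EuclideanSpace ℝ (Fin 3))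
          (p : ℝ → EuclideanSpace ℝ (Fin 3) → ℝ),
          IsMaximalSmoothSolution ν 0 u p T → IsLerayHopfOn T ν 0 (u 0) u →
          HasRapidSpatialDecay (u 0) → IsTypeIBlowup u T →
          ∃ q M δ₀ : ℝ, 0 < δ₀ ∧ ∀ δ : ℝ, 0 < δ → δ ≤ δ₀ → ∃ t ∈ Set.Ico 0 T,
            δ ≤ T - t ∧ T - t ≤ q * δ ∧ eWeakLpPow (u t) 3 volume ≤ ENNReal.ofReal M := by
  unfold LorentzUpgradeTypeI
  constructor
  · intro h ν T hν hT u p hmax hLH hdec hI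
    obtain ⟨M', hM'⟩ := h ν T hν hT u p hmax hLH hdec hI
    refine ⟨1, M', T, hT, fun δ hδ hδT => ⟨T - δ, ⟨by linarith, by linarith⟩, by linarith,
      by linarith, hM' _ ⟨by linarith, by linarith⟩⟩⟩
  · intro h ν T hν hT u p hmax hLH hdec hI
    obtain ⟨q, M, δ₀, hδ₀, hs⟩ := h ν T hν hT u p hmax hLH hdec hI
    exact lorentzBound_of_octaveSampledLorentz hν hT hmax hLH hdec hI hδ₀ hs

open Summit.NavierStokesRegularity.NavierStokesRegularity.Theses.TypeIQuarterGate in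
/-- **BY NAME: the crux `QuarterLawTypeI` ⟺ the OCTAVE-SAMPLED Lorentz bound** (via the tree's
`LorentzOfEnvelope.lorentzUpgradeTypeI_iff_quarterLawTypeI`).  Repair-census wording for
stmt-NavierStokesRegularity-23726: the missing estimate is ONE weak-`L³` slice bound per backward
time-octave near `T`.  `QuarterLawTypeI` remains OPEN. [folklore] -/
theorem quarterLawTypeI_iff_octaveSampledLorentz :
    QuarterLawTypeI ↔
      ∀ (ν T : ℝ), 0 < ν → 0 < T →
        ∀ (u : ℝ → EuclideanSpace ℝ (Fin 3) → EuclideanSpace ℝ (Fin 3))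
          (p : ℝ → EuclideanSpace ℝ (Fin 3) → ℝ),
          IsMaximalSmoothSolution ν 0 u p T → IsLerayHopfOn T ν 0 (u 0) u →
          HasRapidSpatialDecay (u 0) → IsTypeIBlowup u T →
          ∃ q M δ₀ : ℝ, 0 < δ₀ ∧ ∀ δ : ℝ, 0 < δ → δ ≤ δ₀ → ∃ t ∈ Set.Ico 0 T,
            δ ≤ T - t ∧ T - t ≤ q * δ ∧ eWeakLpPow (u t) 3 volume ≤ ENNReal.ofReal M :=
  LorentzOfEnvelope.lorentzUpgradeTypeI_iff_quarterLawTypeI.symm.trans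
    lorentzUpgradeTypeI_iff_octaveSampled


/-! ### Appendix (same session): the DYADIC TIMES alone -/

/-- **Per solution: the weak-`L³` bound at the DYADIC TIMES `t_n = T − T/2^{n+1}` is the full bound**,
along a maximal classical Leray–Hopf solution from a rapidly decaying datum with the sup-norm Type-I
rate at `T` (`lorentzBound_of_lacunaryLorentzSeq` with ratio `q = 2`; dyadic bookkeeping from the tree's
`QuarterLawOctave.dyadic_mem_Ico` / `tendsto_dyadic` / `dyadic_ratio`). [folklore] -/
theorem lorentzBound_of_dyadicTimes {ν T : ℝ} (hν : 0 < ν) (hT : 0 < T)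
    {u : ℝ → EuclideanSpace ℝ (Fin 3) → EuclideanSpace ℝ (Fin 3)}
    {p : ℝ → EuclideanSpace ℝ (Fin 3) → ℝ}
    (hmax : IsMaximalSmoothSolution ν 0 u p T) (hLH : IsLerayHopfOn T ν 0 (u 0) u)
    (hdec : HasRapidSpatialDecay (u 0)) (hI : IsTypeIBlowup u T) {M : ℝ}
    (hdy : ∀ n : ℕ, eWeakLpPow (u (T - T / 2 ^ (n + 1))) 3 volume ≤ ENNReal.ofReal M) :
    ∃ M' : ℝ, ∀ s ∈ Ico 0 T, eWeakLpPow (u s) 3 volume ≤ ENNReal.ofReal M' :=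
  lorentzBound_of_lacunaryLorentzSeq hν hT hmax hLH hdec hI (t := fun n => T - T / 2 ^ (n + 1))
    (q := 2) (M := M) (fun n => QuarterLawOctave.dyadic_mem_Ico hT n) (QuarterLawOctave.tendsto_dyadic T)
    (fun n => QuarterLawOctave.dyadic_ratio T n) hdy

open Summit.NavierStokesRegularity.NavierStokesRegularity.Theses.TypeIQuarterGate in
/-- **BY NAME: `LorentzUpgradeTypeI` ⟺ its DYADIC form** — the weak-`L³` bound only at the times
`t_n = T − T/2^{n+1}`: `∃ M, ∀ n, sup_λ λ³|{λ < ‖u(t_n)‖}| ≤ M`.  `LorentzUpgradeTypeI` remains OPEN.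
[folklore] -/
theorem lorentzUpgradeTypeI_iff_dyadicTimes :
    LorentzUpgradeTypeI ↔
      ∀ (ν T : ℝ), 0 < ν → 0 < T →
        ∀ (u : ℝ → EuclideanSpace ℝ (Fin 3) → EuclideanSpace ℝ (Fin 3))
          (p : ℝ → EuclideanSpace ℝ (Fin 3) → ℝ),
          IsMaximalSmoothSolution ν 0 u p T → IsLerayHopfOn T ν 0 (u 0) u →
          HasRapidSpatialDecay (u 0) → IsTypeIBlowup u T →
          ∃ M : ℝ, ∀ n : ℕ, eWeakLpPow (u (T - T / 2 ^ (n + 1))) 3 volume ≤ ENNReal.ofReal M := by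
  unfold LorentzUpgradeTypeI
  constructor
  · intro h ν T hν hT u p hmax hLH hdec hI
    obtain ⟨M', hM'⟩ := h ν T hν hT u p hmax hLH hdec hI
    exact ⟨M', fun n => hM' _ (QuarterLawOctave.dyadic_mem_Ico hT n)⟩
  · intro h ν T hν hT u p hmax hLH hdec hI
    obtain ⟨M, hM⟩ := h ν T hν hT u p hmax hLH hdec hI
    exact lorentzBound_of_dyadicTimes hν hT hmax hLH hdec hI hM

open Summit.NavierStokesRegularity.NavierStokesRegularity.Theses.TypeIQuarterGate in
/-- **BY NAME: the crux `QuarterLawTypeI` ⟺ the DYADIC weak-`L³` bound** along Type-I blow-ups (via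
the tree's `LorentzOfEnvelope.lorentzUpgradeTypeI_iff_quarterLawTypeI`).  `QuarterLawTypeI` remains
OPEN. [folklore] -/
theorem quarterLawTypeI_iff_dyadicLorentz :
    QuarterLawTypeI ↔
      ∀ (ν T : ℝ), 0 < ν → 0 < T →
        ∀ (u : ℝ → EuclideanSpace ℝ (Fin 3) → EuclideanSpace ℝ (Fin 3))
          (p : ℝ → EuclideanSpace ℝ (Fin 3) → ℝ),
          IsMaximalSmoothSolution ν 0 u p T → IsLerayHopfOn T ν 0 (u 0) u →
          HasRapidSpatialDecay (u 0) → IsTypeIBlowup u T →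
          ∃ M : ℝ, ∀ n : ℕ, eWeakLpPow (u (T - T / 2 ^ (n + 1))) 3 volume ≤ ENNReal.ofReal M :=
  LorentzOfEnvelope.lorentzUpgradeTypeI_iff_quarterLawTypeI.symm.trans lorentzUpgradeTypeI_iff_dyadicTimes

end Summit.NavierStokesRegularity.NavierStokesRegularity.Theorems.LorentzOctave

end
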